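import Summits.ResolutionOfSingularities.ResolutionOfSingularities.Theorems.GaloisDescentLU2
import HarnessLib

/-!
# GaloisDescentLU3 — the DESCENT CUT of the located residual; root by name (decomp-res node «DescentLadder», lens-1 g23), tree companion 3/3

Content VERBATIM from PART C of the decomp-res lens-1 g23 node `HOME/decomp-res-lens-1/g23/DescentLadder.lean`
(HOME = run/shared/lean/pub/decomp-res; NODE-g23.md), re-namespaced `…Theorems.GaloisDescentLU` (one namespace across the
three companion files `GaloisDescentLU`, `GaloisDescentLU2`, `GaloisDescentLU3`, split for the 400-line cap), typed against
the LANDED `Theorems.HenselKeyChainLU` (p803393), `Theorems.KeyChainLU` and `Literature…KrullRamificationHenselSubfields`;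
nothing inlined; a pure addition (no existing file touched).  Landing target:
`Summits/ResolutionOfSingularities/ResolutionOfSingularities/Theorems/GaloisDescentLU3.lean`
(`--kind proof --supports stmt-ResolutionOfSingularities-0641`, HELPER file of the host route `Valuative`).

WINDOW g23 item (K-e) (CRITIC-LEDGER row 167): the COMING-DOWN LAW.  A place `(K, O)` over `k` carrying a GALOIS
HENSEL-DESCENT DATUM — a finite Galois `K′ | K` whose group fixes a valuation ring `O′` above `O` (`G = G_Z`), a
`G`-stable upstairs frame `F′ ⊆ K′` with `F′ ∩ K = F₁` a finitely generated KEY-CHAIN sub-top of `K` (`K | F₁` finite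
separable), and a henselian generator `K′ = F′(η′)` over `O′ ∩ F′` with residue in that of `F′` — is itself a HENSEL
TOP over `F₁` (`henselKeyChainTopBelow_of_galoisHenselDescent`, file 2), hence admits relative local uniformization
(`relLU_of_galoisHenselDescent`, via the landed g22 law `relLU_of_henselKeyChainTop`); the located residual is re-cut
accordingly (`nonKHToricArchLUKeyHensel_iff_descent`, `closes_descent`, file 3).  Hypothesis-free: no port, no `TheoremD`.

THIS FILE (PART C): `NonKHToricArchLUKeyDescentCell e c n` (DECIDED: `nonKHToricArchLUKeyDescentCell_holds`), the new
located residual `NonKHToricArchLUKeyHenselDescent e c n` (off the key-chain, Hensel AND descent cells), the exact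
hypothesis-free cut `nonKHToricArchLUKeyHensel_iff_descent` (+ conjunction form from the g21 residual, the `(3,3,4)`
instance, the g17/g20 family form), `nonKHToricArchLUKeyHenselDescent_of_root` (WEAKER than the root), ROOT BY NAME
`closes_descent`, and `root_iff_descent_sigma`.
-/

noncomputable section

open IntermediateField Polynomial Literature.AlgebraicGeometry.Resolution

namespace Summit.ResolutionOfSingularities.ResolutionOfSingularities.Theorems.GaloisDescentLU

/-! ## PART C — the DESCENT CUT of the located residual; ROOT BY NAME -/

section Cut

open Summit.ResolutionOfSingularities.ResolutionOfSingularities.Theses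
open Summit.ResolutionOfSingularities.ResolutionOfSingularities.Theorems
open Summit.ResolutionOfSingularities.ResolutionOfSingularities.Theorems.KeyChainLU
open Summit.ResolutionOfSingularities.ResolutionOfSingularities.Theorems.HenselKeyChainLU
open Summit.ResolutionOfSingularities.ResolutionOfSingularities.Theorems.PfaffLine
open Summit.ResolutionOfSingularities.ResolutionOfSingularities.Theorems.ToricLadder
open Summit.ResolutionOfSingularities.ResolutionOfSingularities.Theorems.KaplanskyLadder
open Summit.ResolutionOfSingularities.ResolutionOfSingularities.Theorems.PerronLadder
open Summit.ResolutionOfSingularities.ResolutionOfSingularities.Theorems.DefectlessLadder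
open Summit.ResolutionOfSingularities.ResolutionOfSingularities.Theorems.WCut

/-- **DECIDED PIECE** (tag DECIDED — a kernel THEOREM, `nonKHToricArchLUKeyDescentCell_holds`; WEAKER than the
root; located at `(e, c, n) = (3, 3, 4)`): the located residual of g21 (off the key-chain cell) restricted to
the DESCENT CELL `δ < ∞`. -/
def NonKHToricArchLUKeyDescentCell (e c n : ℕ) : Prop :=
  ∀ p : ℕ, p.Prime → ∀ (k K : Type) [Field k] [CharP k p] [Field K] [Algebra k K],
    Algebra.trdeg k K ≤ n → ∀ O : ValuationSubring K, Nonempty O.valuation.RankOne →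
    (∀ y ∈ O, ∃ f : Polynomial k, f ≠ 0 ∧ Polynomial.aeval y f ∈ O.nonunits) →
    ¬ IsAbhyankarPlace O (algebraMap k K).fieldRange ⊤ →
    ¬ (∃ d : ℕ, d < n ∧ SepDenseBelow k O d) → ¬ ToricDenseBelow k O e → ¬ KHTopBelow k O c →
    ¬ KeyChainTopBelow k O → GaloisHenselDescentDatum k O → RelLocalUniformization k K O

/-- THE LAW DECIDES THE CELL PIECE outright, for all parameters (no port, no hypothesis). [folklore] -/
theorem nonKHToricArchLUKeyDescentCell_holds (e c n : ℕ) : NonKHToricArchLUKeyDescentCell e c n :=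
  fun _ _ _ _ _ _ _ _ _ _ _ _ _ _ _ _ _ hD => relLU_of_galoisHenselDescent hD

/-- **NEW LOCATED RESIDUAL** (tag UNDECIDED · WEAKER than the root · located at `(e, c, n) = (3, 3, 4)`): the
located residual OFF the key-chain cell, OFF the Hensel cell AND OFF the descent cell — the places of descent
index `δ = ∞`: no finite Galois extension fixing `O′` makes the Hensel datum visible over a stable frame with
key-chain invariants. -/
def NonKHToricArchLUKeyHenselDescent (e c n : ℕ) : Prop :=
  ∀ p : ℕ, p.Prime → ∀ (k K : Type) [Field k] [CharP k p] [Field K] [Algebra k K],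
    Algebra.trdeg k K ≤ n → ∀ O : ValuationSubring K, Nonempty O.valuation.RankOne →
    (∀ y ∈ O, ∃ f : Polynomial k, f ≠ 0 ∧ Polynomial.aeval y f ∈ O.nonunits) →
    ¬ IsAbhyankarPlace O (algebraMap k K).fieldRange ⊤ →
    ¬ (∃ d : ℕ, d < n ∧ SepDenseBelow k O d) → ¬ ToricDenseBelow k O e → ¬ KHTopBelow k O c →
    ¬ KeyChainTopBelow k O → ¬ HenselKeyChainTopBelow k O → ¬ GaloisHenselDescentDatum k O →
    RelLocalUniformization k K O

/-- Dropping the extra negated hypothesis. [folklore] -/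
theorem nonKHToricArchLUKeyHenselDescent_of_hensel {e c n : ℕ} (h : NonKHToricArchLUKeyHensel e c n) :
    NonKHToricArchLUKeyHenselDescent e c n :=
  fun p hp k K _ _ _ _ hd O h1 h0 hA hnd hnt hnk hkey hH _ =>
    h p hp k K hd O h1 h0 hA hnd hnt hnk hkey hH

/-- **THE DESCENT CUT** (kernel, exact, hypothesis-free): the g22 located residual is EQUIVALENT to its part
off the descent cell — by the law, off the Hensel cell the descent datum is absent. [folklore] -/
theorem nonKHToricArchLUKeyHensel_iff_descent {e c n : ℕ} :
    NonKHToricArchLUKeyHensel e c n ↔ NonKHToricArchLUKeyHenselDescent e c n := by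
  refine ⟨nonKHToricArchLUKeyHenselDescent_of_hensel,
    fun h p hp k K _ _ _ _ hd O hr hz hA hnd hnt hnk hkey hH => ?_⟩
  exact h p hp k K hd O hr hz hA hnd hnt hnk hkey hH (not_galoisHenselDescentDatum_of_not_hensel hH)

/-- The same cut as a conjunction «decided cell piece ∧ new residual», starting from the g21 residual
`NonKHToricArchLUKey` (off the key-chain cell): Hensel cell, descent cell, remainder. [folklore] -/
theorem nonKHToricArchLUKey_iff_cells_and_descent {e c n : ℕ} :
    NonKHToricArchLUKey e c n ↔ NonKHToricArchLUKeyHenselCell e c n ∧ NonKHToricArchLUKeyDescentCell e c n ∧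
      NonKHToricArchLUKeyHenselDescent e c n := by
  rw [nonKHToricArchLUKey_iff_hensel, nonKHToricArchLUKeyHensel_iff_descent]
  exact ⟨fun h => ⟨nonKHToricArchLUKeyHenselCell_holds e c n, nonKHToricArchLUKeyDescentCell_holds e c n, h⟩,
    fun h => h.2.2⟩

/-- The EXACT re-location at the programme's parameters `(3, 3, 4)` (the form named in the g23 window).
[folklore] -/
theorem nonKHToricArchLUKeyHensel334_iff_descent :
    NonKHToricArchLUKeyHensel 3 3 4 ↔ NonKHToricArchLUKeyHenselDescent 3 3 4 :=
  nonKHToricArchLUKeyHensel_iff_descent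

/-- The TRUE residual family of g17/g20 (`NonKHToricArchLU`) re-located: off the key-chain, Hensel and descent
cells. [folklore] -/
theorem nonKHToricArchLU_iff_descent {e c n : ℕ} :
    NonKHToricArchLU e c n ↔ NonKHToricArchLUKeyHenselDescent e c n :=
  nonKHToricArchLU_iff_hensel.trans nonKHToricArchLUKeyHensel_iff_descent

/-- The new residual follows from the root outright (it is a WEAKER piece). [folklore] -/
theorem nonKHToricArchLUKeyHenselDescent_of_root (hS : _root_.ResolutionOfSingularities) (e c n : ℕ) :
    NonKHToricArchLUKeyHenselDescent e c n :=
  nonKHToricArchLUKeyHenselDescent_of_hensel (nonKHToricArchLUKeyHensel_of_root hS e c n)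

/-- **`closes_descent` — ROOT BY NAME (deciding theorem of this node).**  Cossart–Piltant floor (print) +
CJS-2020 (named fact) + the KK05 (NC)+(V) ascent Π₁ (print) + the located residual OFF THE KEY-CHAIN, HENSEL
AND DESCENT CELLS in transcendence degree `≥ 4` + the patching crux 0642 ⇒ `ResolutionOfSingularities`; all
three cells are discharged INSIDE the kernel. [folklore] -/
theorem closes_descent (hCP : CossartPiltant2019LU3.{0}) (hCJS : CossartJannsenSaito2020Embedded.{0})
    (hAsc : KK05NCVAscent) (hN : ∀ d, 4 ≤ d → NonKHToricArchLUKeyHenselDescent 3 3 d)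
    (h₃ : Valuative.PatchingRel) : _root_.ResolutionOfSingularities :=
  closes_hensel hCP hCJS hAsc (fun d hd => nonKHToricArchLUKeyHensel_iff_descent.2 (hN d hd)) h₃

/-- Root-level summary: modulo floor + CJS + Π₁ + 0642 the ROOT is EQUIVALENT to the residual family off the
three cells. [folklore] -/
theorem root_iff_descent_sigma (hCP : CossartPiltant2019LU3.{0})
    (hCJS : CossartJannsenSaito2020Embedded.{0}) (hAsc : KK05NCVAscent) (h₃ : Valuative.PatchingRel) :
    _root_.ResolutionOfSingularities ↔ ∀ d, 4 ≤ d → NonKHToricArchLUKeyHenselDescent 3 3 d := by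
  rw [root_iff_hensel_sigma hCP hCJS hAsc h₃]
  exact forall₂_congr fun d _ => nonKHToricArchLUKeyHensel_iff_descent

end Cut

end Summit.ResolutionOfSingularities.ResolutionOfSingularities.Theorems.GaloisDescentLU

end
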